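import Literature.Analysis.FluidPDE.WholeSpaceIBP
import Literature.Analysis.FunctionSpaces.WeakDerivInner
import HarnessLib

/-!
# The weak Laplacian of the inner product of two `W^{1,2}` fields, tested

Analysis/FluidPDE theorem file (no new definitions, everything PROVED), on the inline proof path
of the named fact `Literature.Analysis.FluidPDE.local_leray_weak_strong_uniqueness`
(Lemarié-Rieusset 2016, Thm. 14.7). In the balance of `u₁·u₂` (file p. 515,
"`∂ₜ(u₁·u₂) = νΔ(u₁·u₂) - 2ν∇ ⊗ u₁·∇ ⊗ u₂ + …`") obtained from the weak formulation with
`H¹` test fields, the viscous term appears as `-ν∫ ∑ᵢ ∂ᵢφ (⟨∂ᵢu₁, u₂⟩ + ⟨∂ᵢu₂, u₁⟩)`, while the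
local energy inequalities carry `ν∫ |uᵢ|² Δφ`; the two are matched by the tested weak product
rule

* `integral_laplacian_mul_inner_eq_neg_sum` — for `c, d ∈ W^{1,2}(B)` (weak derivatives
  `Gc, Gd` on the ball `B = B(x₀, ρ)`, `c, d, Gc, Gd ∈ L²(B)`) and `φ ∈ C_c^∞(B)`,
  `∫ Δφ ⟨c, d⟩ = -∫ ∑ᵢ ∂ᵢφ (⟨Gc eᵢ, d⟩ + ⟨c, Gd eᵢ⟩)`, `(eᵢ)` the standard orthonormal frame
  (`integral_fderiv_fderiv_mul_inner_eq_neg`, `WeakDerivInner.lean`, summed over the frame,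
  `Δφ = ∑ᵢ ∂ᵢ∂ᵢφ`).

## References

* P. G. Lemarié-Rieusset, *The Navier–Stokes Problem in the 21st Century* (2016), Thm. 14.7,
  proof, file p. 515. [`LemarieRieusset2016`]
* L. C. Evans, *Partial Differential Equations* (2010), §5.2.3 Thm. 1 (iv). [`Evans2010`]
-/

noncomputable section

open MeasureTheory TopologicalSpace Set Function Filter Topology InnerProductSpace Metric
open scoped RealInnerProductSpace ENNReal NNReal ContDiff Laplacian

namespace Literature.Analysis.FluidPDE

-- nested operator types (`innerSL … ∘L …`)
set_option maxSynthPendingDepth 3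

/-- **`∫ Δφ ⟨c, d⟩ = -∫ ∑ᵢ ∂ᵢφ (⟨Gc eᵢ, d⟩ + ⟨c, Gd eᵢ⟩)`** for `c, d ∈ W^{1,2}(B(x₀, ρ))` and
`φ ∈ C_c^∞(B(x₀, ρ))` (the weak form of "`∫ Δφ (u₁·u₂) = -∫ ∇φ·∇(u₁·u₂)`", Lemarié-Rieusset
2016, Thm. 14.7, proof, p. 515; Evans §5.2.3 Thm. 1 (iv)). [cite: LemarieRieusset2016, Thm. 14.7, proof (file p. 515)] -/
theorem integral_laplacian_mul_inner_eq_neg_sum {c d : EuclideanSpace ℝ (Fin 3) → EuclideanSpace ℝ (Fin 3)}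
    {Gc Gd : EuclideanSpace ℝ (Fin 3) → EuclideanSpace ℝ (Fin 3) →L[ℝ] EuclideanSpace ℝ (Fin 3)}
    {x₀ : EuclideanSpace ℝ (Fin 3)} {ρ : ℝ}
    (hc : FunctionSpaces.HasWeakFDerivOn ⟨ball x₀ ρ, isOpen_ball⟩ volume c Gc)
    (hd : FunctionSpaces.HasWeakFDerivOn ⟨ball x₀ ρ, isOpen_ball⟩ volume d Gd)
    (hc2 : MemLp c 2 (volume.restrict (ball x₀ ρ))) (hd2 : MemLp d 2 (volume.restrict (ball x₀ ρ)))
    (hGc2 : MemLp Gc 2 (volume.restrict (ball x₀ ρ))) (hGd2 : MemLp Gd 2 (volume.restrict (ball x₀ ρ)))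
    {φ : EuclideanSpace ℝ (Fin 3) → ℝ}
    (hφ : FunctionSpaces.IsTestFunctionOn (⟨ball x₀ ρ, isOpen_ball⟩ : Opens (EuclideanSpace ℝ (Fin 3))) φ) :
    ∫ x, (Δ φ) x * ⟪c x, d x⟫ =
      -∫ x, ∑ i, fderiv ℝ φ x (stdOrthonormalBasis ℝ (EuclideanSpace ℝ (Fin 3)) i) *
        (⟪Gc x (stdOrthonormalBasis ℝ (EuclideanSpace ℝ (Fin 3)) i), d x⟫ +
          ⟪c x, Gd x (stdOrthonormalBasis ℝ (EuclideanSpace ℝ (Fin 3)) i)⟫) := by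
  set e := stdOrthonormalBasis ℝ (EuclideanSpace ℝ (Fin 3)) with he
  set B : Set (EuclideanSpace ℝ (Fin 3)) := ball x₀ ρ with hB
  set U : Opens (EuclideanSpace ℝ (Fin 3)) := ⟨ball x₀ ρ, isOpen_ball⟩ with hU
  have hUB : (U : Set (EuclideanSpace ℝ (Fin 3))) = B := rfl
  have hGc2v : ∀ v, MemLp (fun x => Gc x v) 2 (volume.restrict B) := fun v =>
    (ContinuousLinearMap.apply ℝ (EuclideanSpace ℝ (Fin 3)) v).comp_memLp' hGc2
  have hGd2v : ∀ v, MemLp (fun x => Gd x v) 2 (volume.restrict B) := fun v =>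
    (ContinuousLinearMap.apply ℝ (EuclideanSpace ℝ (Fin 3)) v).comp_memLp' hGd2
  -- the tested product rule, one direction at a time (set integrals over the ball)
  have key : ∀ i, ∫ x in B, fderiv ℝ (fderiv ℝ φ) x (e i) (e i) * ⟪c x, d x⟫ =
      -∫ x in B, fderiv ℝ φ x (e i) * (⟪Gc x (e i), d x⟫ + ⟪c x, Gd x (e i)⟫) := fun i =>
    FunctionSpaces.integral_fderiv_fderiv_mul_inner_eq_neg hc2 hd2 hc hd hGc2v hGd2v hφ (e i) (e i)
  -- smoothness and supports
  have hφ2 : ContDiff ℝ 2 φ := hφ.contDiff.of_le (by norm_cast)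
  have hDφd : Differentiable ℝ (fderiv ℝ φ) :=
    (hφ.contDiff.fderiv_right (m := (⊤ : ℕ∞)) le_rfl).differentiable (by simp)
  have hlap : ∀ x, (Δ φ) x = ∑ i, fderiv ℝ (fderiv ℝ φ) x (e i) (e i) := by
    intro x
    rw [laplacian_eq_sum_fderiv_fderiv e hφ2 x]
    refine Finset.sum_congr rfl fun i _ => ?_
    rw [fderiv_clm_apply (hDφd x) (differentiableAt_const (e i))]
    simp
  have hφ0 : ∀ x, x ∉ B → φ x = 0 := fun x hx =>
    image_eq_zero_of_notMem_tsupport fun h => hx (hφ.tsupport_subset h)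
  have hDφ0 : ∀ x, x ∉ B → fderiv ℝ φ x = 0 := fun x hx =>
    fderiv_of_notMem_tsupport ℝ fun h => hx (hφ.tsupport_subset h)
  have hLap0 : ∀ x, x ∉ B → (Δ φ) x = 0 := fun x hx =>
    laplacian_eq_zero_of_notMem_tsupport fun h => hx (hφ.tsupport_subset h)
  -- integrability of the individual terms on the ball
  haveI hfin : IsFiniteMeasure ((volume : Measure (EuclideanSpace ℝ (Fin 3))).restrict B) :=
    isFiniteMeasure_restrict.2 measure_ball_lt_top.ne
  have hcd1 : Integrable (fun x => ⟪c x, d x⟫) (volume.restrict B) := by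
    have h' : MemLp (fun x => ‖c x‖ * ‖d x‖) 1 (volume.restrict B) := hd2.norm.mul' hc2.norm
    have h : MemLp (fun x => ⟪c x, d x⟫) 1 (volume.restrict B) := by
      refine h'.of_le_mul (c := 1) (hc2.1.inner hd2.1) (Eventually.of_forall fun x => ?_)
      rw [one_mul, Real.norm_eq_abs, Real.norm_eq_abs, abs_of_nonneg (by positivity : (0 : ℝ) ≤ ‖c x‖ * ‖d x‖)]
      exact abs_real_inner_le_norm _ _
    exact memLp_one_iff_integrable.1 h
  have hGd1 : ∀ i, Integrable (fun x => ⟪Gc x (e i), d x⟫ + ⟪c x, Gd x (e i)⟫) (volume.restrict B) := by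
    intro i
    have h1 : MemLp (fun x => ‖Gc x (e i)‖ * ‖d x‖) 1 (volume.restrict B) := hd2.norm.mul' (hGc2v (e i)).norm
    have h2 : MemLp (fun x => ‖c x‖ * ‖Gd x (e i)‖) 1 (volume.restrict B) := (hGd2v (e i)).norm.mul' hc2.norm
    have hm : AEStronglyMeasurable (fun x => ⟪Gc x (e i), d x⟫ + ⟪c x, Gd x (e i)⟫) (volume.restrict B) :=
      ((hGc2v (e i)).1.inner hd2.1).add (hc2.1.inner (hGd2v (e i)).1)
    have h : MemLp (fun x => ⟪Gc x (e i), d x⟫ + ⟪c x, Gd x (e i)⟫) 1 (volume.restrict B) := by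
      refine (h1.add h2).of_le_mul (c := 1) hm (Eventually.of_forall fun x => ?_)
      rw [one_mul, Real.norm_eq_abs, Real.norm_eq_abs]
      simp only [Pi.add_apply]
      rw [abs_of_nonneg (by positivity : (0 : ℝ) ≤ ‖Gc x (e i)‖ * ‖d x‖ + ‖c x‖ * ‖Gd x (e i)‖)]
      calc |⟪Gc x (e i), d x⟫ + ⟪c x, Gd x (e i)⟫| ≤ |⟪Gc x (e i), d x⟫| + |⟪c x, Gd x (e i)⟫| := abs_add_le _ _
        _ ≤ ‖Gc x (e i)‖ * ‖d x‖ + ‖c x‖ * ‖Gd x (e i)‖ :=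
            add_le_add (abs_real_inner_le_norm _ _) (abs_real_inner_le_norm _ _)
    exact memLp_one_iff_integrable.1 h
  -- bounds for the derivatives of `φ`
  have hD2c : Continuous (fderiv ℝ (fderiv ℝ φ)) :=
    (hφ.contDiff.fderiv_right (m := (⊤ : ℕ∞)) le_rfl).continuous_fderiv (by simp)
  obtain ⟨C2, hC2⟩ := hD2c.bounded_above_of_compact_support ((hφ.hasCompactSupport.fderiv ℝ).fderiv ℝ)
  have hDc : Continuous (fderiv ℝ φ) := hφ.contDiff.continuous_fderiv (by simp)
  obtain ⟨C1, hC1⟩ := hDc.bounded_above_of_compact_support (hφ.hasCompactSupport.fderiv ℝ)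
  have he1 : ∀ i, ‖e i‖ = 1 := fun i => e.orthonormal.1 i
  have hT1 : ∀ i, Integrable (fun x => fderiv ℝ (fderiv ℝ φ) x (e i) (e i) * ⟪c x, d x⟫) (volume.restrict B) := by
    intro i
    refine hcd1.bdd_mul (c := C2) ((hD2c.clm_apply continuous_const).clm_apply continuous_const).aestronglyMeasurable
      (Eventually.of_forall fun x => ?_)
    calc ‖fderiv ℝ (fderiv ℝ φ) x (e i) (e i)‖ ≤ ‖fderiv ℝ (fderiv ℝ φ) x (e i)‖ * ‖e i‖ := ContinuousLinearMap.le_opNorm _ _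
      _ ≤ (‖fderiv ℝ (fderiv ℝ φ) x‖ * ‖e i‖) * ‖e i‖ := by gcongr; exact ContinuousLinearMap.le_opNorm _ _
      _ ≤ C2 := by rw [he1 i, mul_one, mul_one]; exact hC2 x
  have hT2 : ∀ i, Integrable (fun x => fderiv ℝ φ x (e i) * (⟪Gc x (e i), d x⟫ + ⟪c x, Gd x (e i)⟫))
      (volume.restrict B) := by
    intro i
    refine (hGd1 i).bdd_mul (c := C1) ((hDc.clm_apply continuous_const).aestronglyMeasurable)
      (Eventually.of_forall fun x => ?_)
    calc ‖fderiv ℝ φ x (e i)‖ ≤ ‖fderiv ℝ φ x‖ * ‖e i‖ := ContinuousLinearMap.le_opNorm _ _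
      _ ≤ C1 := by rw [he1 i, mul_one]; exact hC1 x
  -- from the whole space to the ball
  have hL : ∫ x, (Δ φ) x * ⟪c x, d x⟫ = ∫ x in B, ∑ i, fderiv ℝ (fderiv ℝ φ) x (e i) (e i) * ⟪c x, d x⟫ := by
    rw [← setIntegral_eq_integral_of_forall_compl_eq_zero (s := B) (fun x hx => by rw [hLap0 x hx, zero_mul])]
    refine integral_congr_ae (Eventually.of_forall fun x => ?_)
    simp only [hlap x, Finset.sum_mul]
  have hR : ∫ x, ∑ i, fderiv ℝ φ x (e i) * (⟪Gc x (e i), d x⟫ + ⟪c x, Gd x (e i)⟫) =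
      ∫ x in B, ∑ i, fderiv ℝ φ x (e i) * (⟪Gc x (e i), d x⟫ + ⟪c x, Gd x (e i)⟫) := by
    rw [← setIntegral_eq_integral_of_forall_compl_eq_zero (s := B) (fun x hx => ?_)]
    exact Finset.sum_eq_zero fun i _ => by rw [hDφ0 x hx]; simp
  rw [hL, hR, integral_finsetSum _ (fun i _ => hT1 i), integral_finsetSum _ (fun i _ => hT2 i),
    ← Finset.sum_neg_distrib]
  exact Finset.sum_congr rfl fun i _ => key i

end Literature.Analysis.FluidPDE
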